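import Summits.Ventures.HodgeRepro2.T6HostHodge
import Summits.Ventures.HodgeRepro2.T6A1HostBetti

/-!
# T6ShadowHost — the host-side composite of Theorem A on the (S4) object (skeleton, t6-lead g4)

Cell pub-hodge-repro2, Tier 6 (README §10), seat t6-lead. THE SHAPE of the proof of `hccm_of_published`
(T6Main): for every corner product `C` over a sextic Galois CM field, `SplitWeilAlgebraic C` from
(i) the lead's displays — `Hyp.BettiHodge coeffC` (clauses (a)/(b)/(c) of `T6HostBetti`) with the naturality
of `coeffC` (`CoeffNatural`), (ii) t6-p1's A1 host side (`T6A1HostBetti.splitWeilAlgebraic_of_periodN`: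
Lemma 1.1.17 `h17`, Lange at `n = 4` `e` / `he` / `h4`), (iii) a transfer shadow `D` of the face (t6-p2's
`transferShadowWeil`) whose degree-2 algebraic classes go to the host's `coniveau` (`halg`), and
(iv) `Hyp.PeriodN D` (the N side, M2 = `T6PeriodInput3.periodInputN_of_published₃`).
The binders `hT` / `hcA` / `hcB` of the A1 side are DISCHARGED here from the clauses (`T6HostHodge`).
No `sorry`; standard axioms.
§8(d): uses an L-value-free non-vanishing device: NO.
-/

noncomputable section

open CategoryTheory
open scoped TensorProduct
open HostAPI.Carriers.AlgebraicGeometry.Motives HostAPI.Carriers.AlgebraicGeometry.HodgeTheory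

namespace Summit.Ventures.HodgeRepro2.T6.Host

open Summit.Ventures.HodgeRepro2.T6 Summit.Ventures.HodgeRepro2.T6.A1HostBetti
open Summit.Ventures.HodgeRepro2.T6.A1Dict Summit.Ventures.HodgeRepro2.T6.A1DictRat
  Summit.Ventures.HodgeRepro2.T6.A1BaseChange

variable {K : Type} [Field K] [NumberField K] [NumberField.IsCMField K]
  (coeffC : ∀ (X : SchemeOver ℂ) (k : ℕ), HC X k →ₗ[ℂ] H X k) (Bd : BettiHodgeData ℂ)

/-- THE A1 SIDE OF THE HOST COMPOSITE, with `hT` / `hcA` / `hcB` discharged from the clauses: the identification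
`hostIdentW` of the corner product's `H¹`, now a function of the clauses alone. -/
def hostIdentW_of_clauses (hnat : CoeffNatural coeffC) (hB : BettiClauses coeffC Bd) (C : CornerProduct K)
    (h17 : Lemma1117Q) (e : ⋀[ℂ]^4 (HC C.B.X 1) ≃ₗ[ℂ] HC C.B.X (2 * 2))
    (he : ∀ v : Fin 4 → HC C.B.X 1, e (exteriorPower.ιMulti ℂ 4 v) = cup4C (v 0) (v 1) (v 2) (v 3))
    (h4 : ∀ c : HC C.B.X (2 * 2), c ∈ (ratC : Submodule ℚ (HC C.B.X (2 * 2))) →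
      ∃ (n : ℕ) (q : Fin n → ℚ) (r : Fin n → Fin 4 → HC C.B.X 1),
        (∀ i j, r i j ∈ (ratC : Submodule ℚ (HC C.B.X 1))) ∧
          c = ∑ i, (q i : ℂ) • cup4C (r i 0) (r i 1) (r i 2) (r i 3)) :
    H1Ident K (HC C.B.X 1) (HC C.B.X (2 * 2)) (bcAct C.act) (fun a b c d => cup4C a b c d)
      (· ∈ (ratC : Submodule ℚ (HC C.B.X (2 * 2)))) :=
  hostIdentW Bd C (hT_of_clauses coeffC Bd hnat hB.1 hB.2.2 C)
    (fun i => isCompl_hodgeHC_one Bd hB.2.2 (C.A i).smooth) (isCompl_hodgeHC_one Bd hB.2.2 C.smooth) h17 e he h4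

/-- THE HOST COMPOSITE on the (S4) object: `Hyp.PeriodN D → SplitWeilAlgebraic C` from the clauses, the A1
displays and a transfer shadow with algebraic `Alg 2`. -/
theorem splitWeilAlgebraic_of_clauses [IsGalois ℚ K] (hnat : CoeffNatural coeffC) (hB : BettiClauses coeffC Bd)
    (C : CornerProduct K) (h17 : Lemma1117Q) (e : ⋀[ℂ]^4 (HC C.B.X 1) ≃ₗ[ℂ] HC C.B.X (2 * 2))
    (he : ∀ v : Fin 4 → HC C.B.X 1, e (exteriorPower.ιMulti ℂ 4 v) = cup4C (v 0) (v 1) (v 2) (v 3))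
    (h4 : ∀ c : HC C.B.X (2 * 2), c ∈ (ratC : Submodule ℚ (HC C.B.X (2 * 2))) →
      ∃ (n : ℕ) (q : Fin n → ℚ) (r : Fin n → Fin 4 → HC C.B.X 1),
        (∀ i j, r i j ∈ (ratC : Submodule ℚ (HC C.B.X 1))) ∧
          c = ∑ i, (q i : ℂ) • cup4C (r i 0) (r i 1) (r i 2) (r i 3))
    (D : TransferShadow C.F)
    (halg : ∀ y ∈ D.Alg 2, (hostIdentW_of_clauses coeffC Bd hnat hB C h17 e he h4).φ₄ (extC K y) ∈
      (coniveau C.B.X (2 * 2) 2).baseChange ℂ)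
    (hN : Hyp.PeriodN D) : SplitWeilAlgebraic C :=
  splitWeilAlgebraic_of_periodN Bd C (hT_of_clauses coeffC Bd hnat hB.1 hB.2.2 C)
    (fun i => isCompl_hodgeHC_one Bd hB.2.2 (C.A i).smooth) (isCompl_hodgeHC_one Bd hB.2.2 C.smooth)
    h17 e he h4 D halg hN

end Summit.Ventures.HodgeRepro2.T6.Host

end
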